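import Summits.Ventures.PercRepro.ProfileGapMonoOneColoop
import Summits.Ventures.PercRepro.ProfileGapMonoReduce

/-!
# PercRepro — THE INSTANCE `q = 1` OF THE GAP-MONOTONICITY CONJECTURE IS A THEOREM: the co-rank-1 row of every finite
matroid, and the rule `GapMonoRuleQ α 1 u` (p10, gen 7; `proofs/P10-AVFULL.md` §13)

`profileIneqMinusQ_one_all (K) (u) (hu : 2 ≤ u) : ProfileIneqMinusQ K 1 u` — the co-rank-1 row of EVERY finite matroid
at every level, by strong induction on `#E`: a loop is gap-monotone (`gapMonoQ_of_loop`, the row of `K ∖ ℓ` is the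
induction hypothesis), a parallel element is gap-monotone (`gapMonoQ_of_parallel`, through the row `q = 0` of
`(K ∖ z) ／ z'`, `profileIneqMinusQ_zero`), and in a simple matroid every point is gap-monotone
(`gapMonoQ_one_of_simple_all`).  `gapMonoRuleQ_one (u) (hu : 2 ≤ u) : GapMonoRuleQ α 1 u` — the rule of
`c025_of_gapMonoRuleQ` holds for `q = 1`.

* **`profileIneqMinusQ_one_all`**, `profileIneq_one_all'`, **`gapMonoRuleQ_one`**.
-/

open scoped Matroid

namespace PercRepro.Cogirth

open Finset ThmH Skew Shadow Profile

variable {α : Type} [DecidableEq α]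

/-- A gap-monotone point for `q = 1` in every matroid on at least `u + 2` elements, given the co-rank-1 row of the
one-point deletions. -/
theorem exists_gapMonoQ_one (K : Matroid α) [K.Finite] {u : ℕ} (hu : 2 ≤ u) (hn : u + 2 ≤ (gr K).card)
    (hrow : ∀ z ∈ gr K, ProfileIneqMinusQ (K ＼ ({z} : Set α)) 1 u) : ∃ z ∈ gr K, GapMonoQ K z 1 u := by
  by_cases hl : ∃ ℓ ∈ gr K, rk K {ℓ} = 0
  · obtain ⟨ℓ, hℓ, h0⟩ := hl
    exact ⟨ℓ, hℓ, gapMonoQ_of_loop hℓ h0 (hrow ℓ hℓ)⟩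
  push Not at hl
  have h1 : ∀ x ∈ gr K, rk K {x} = 1 := by
    intro x hx
    have := rk_le_card (M := K) ({x} : Finset α)
    rw [card_singleton] at this
    have := hl x hx
    omega
  by_cases hp : ∃ z ∈ gr K, ∃ z' ∈ gr K, z ≠ z' ∧ rk K {z, z'} = 1
  · obtain ⟨z, hz, z', hz', hzz', hpar⟩ := hp
    refine ⟨z, hz, gapMonoQ_of_parallel hz hz' hzz' (h1 z hz) (h1 z' hz') hpar le_rfl (by omega) ?_⟩
    exact profileIneqMinusQ_zero _ (u - 1)
  push Not at hp
  have h2 : ∀ x ∈ gr K, ∀ y ∈ gr K, x ≠ y → rk K {x, y} = 2 := by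
    intro x hx y hy hxy
    have hle := rk_le_card (M := K) ({x, y} : Finset α)
    rw [card_pair hxy] at hle
    have hge : rk K {x} ≤ rk K {x, y} := rk_mono_sub (by simp)
    have hne := hp x hx y hy hxy
    have := h1 x hx
    omega
  obtain ⟨z, hz⟩ : (gr K).Nonempty := card_pos.1 (by omega)
  exact ⟨z, hz, gapMonoQ_one_of_simple_all (simple'_of_rk_one_two h1 h2) hz hu⟩

/-- **The co-rank-1 row of every finite matroid** at every level `u ≥ 2` (strong induction on `#E`). -/
theorem profileIneqMinusQ_one_all_aux (u : ℕ) (hu : 2 ≤ u) (n : ℕ) :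
    ∀ (K : Matroid α) [K.Finite], (gr K).card = n → ProfileIneqMinusQ K 1 u := by
  induction n using Nat.strong_induction_on with
  | _ n ih =>
    intro K _ hn
    by_cases hsmall : (gr K).card ≤ u + 1
    · exact profileIneqMinusQ_of_card_le (by omega) hsmall
    push Not at hsmall
    have hrow : ∀ z ∈ gr K, ProfileIneqMinusQ (K ＼ ({z} : Set α)) 1 u := by
      intro z hz
      have hcard : (gr (K ＼ ({z} : Set α))).card = n - 1 := by
        rw [gr_delete', card_erase_of_mem hz, hn]
      have hlt : n - 1 < n := by
        have := card_pos.2 ⟨z, hz⟩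
        omega
      exact ih (n - 1) hlt _ hcard
    obtain ⟨z, hz, hgm⟩ := exists_gapMonoQ_one K hu (by omega) hrow
    exact profileIneqMinusQ_of_gapMonoQ hgm (hrow z hz)

/-- **THEOREM: the co-rank-1 row `ProfileIneqMinusQ K 1 u` holds for every finite matroid and every `u ≥ 2`.** -/
theorem profileIneqMinusQ_one_all (K : Matroid α) [K.Finite] {u : ℕ} (hu : 2 ≤ u) : ProfileIneqMinusQ K 1 u :=
  profileIneqMinusQ_one_all_aux u hu _ K rfl

/-- The plain row `q = 1` (again), now from the gap-monotonicity induction. -/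
theorem profileIneq_one_all' (K : Matroid α) [K.Finite] {u : ℕ} (hu : 2 ≤ u) : ProfileIneq K 1 u :=
  profileIneq_of_minusQ (by omega) (profileIneqMinusQ_one_all K hu)

/-- **THEOREM: the gap-monotonicity rule holds for `q = 1`** — every finite matroid on at least `u + 2` elements has a
point `z` with `GapMonoQ K z 1 u` (`u ≥ 2`). -/
theorem gapMonoRuleQ_one (u : ℕ) (hu : 2 ≤ u) : GapMonoRuleQ α 1 u := by
  intro K _ hn
  exact exists_gapMonoQ_one K hu (by omega) (fun z _ => profileIneqMinusQ_one_all _ hu)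

end PercRepro.Cogirth
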